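import Summits.NavierStokesRegularity.NavierStokesRegularity.Theorems.ScenarioCensusRowA5FsCycle
import HarnessLib

/-!
# Census rows A5fe / A5fi (ns-idea-4 LINE «one-cycle» = the Feller–swirl dictionary) — part 5/7: §3b the annular-box barrier ENGINE `radialBarrier_le`

Part 5 of 7 of the port of `OneCycle_v2_3.lean` (sha16 f100b791173babd1); see `ScenarioCensusRowA5FsBox.lean` for the port note.
No census value is asserted here; Row_A5 and NS regularity are NOT proved; no summit statement is proved by this file.
-/

noncomputable section
set_option linter.dupNamespace false

open MeasureTheory Set Function Filter Topology InnerProductSpace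
open scoped Laplacian RealInnerProductSpace ContDiff ENNReal

namespace Summit.NavierStokesRegularity.NavierStokesRegularity.Theorems.ScenarioCensus.FellerSwirl

open Literature.Analysis.FluidPDE
open Summit.NavierStokesRegularity.NavierStokesRegularity.Theorems.ScenarioCensus (Row_A5 Row_A5fe Row_A5fi row_A5fi_of_row_A5fe)

/-- PROVED (g19). **The annular-box barrier engine.** Let `(f, u)` be a swirl pair, `0 < r_in ≤ r_out`, and `p` a
radial profile, `C²` on `(0, ∞)`, nonnegative on `[r_in, r_out]`, which is a super-solution of the swirl operator there:
`p″(r) + ((m − 1)/r) p′(r) ≤ 0` for the inflow number `m = −(x₀u₀ + x₁u₁)` of the actual drift at every `(t, x)` with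
`r_in ≤ r ≤ r_out`. If `f ≤ F` everywhere and `f ≤ p` on the two cylinders `{r = r_in}`, `{r = r_out}`, then `f ≤ p(r)` on
`{r_in ≤ r ≤ r_out}`. Proof: S1 on the compact box `{r_in ≤ r ≤ r_out, |z − z*| ≤ Z} × [t* − T, t*]` with the barrier
`p(r) + F e^{−μ(t−t_b)} Φ(r) + F e^{ν(t−t_b)} cosh(z − z*)/cosh Z` (`initialCorrector_ineq`, `lateralCorrector_ineq`,
`radial_operator`, `lateral_slice`), then `Z → ∞` and `T → ∞`. -/
theorem radialBarrier_le (hS1 : BoxComparison) {f : ℝ → E3 → ℝ} {u : ℝ → E3 → E3} {Cg Cu : ℝ}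
    (hp : IsSwirlPair f u Cg Cu) {rin rout : ℝ} (hrin : 0 < rin) (hio : rin ≤ rout)
    {p : ℝ → ℝ} (hpC : ContDiffOn ℝ 2 p (Ioi 0))
    (hineq : ∀ t < 0, ∀ x, rin ≤ cylRadius x → cylRadius x ≤ rout →
      iteratedDeriv 2 p (cylRadius x)
        + (-(x 0 * u t x 0 + x 1 * u t x 1) - 1) / cylRadius x * deriv p (cylRadius x) ≤ 0)
    (hp0 : ∀ r, rin ≤ r → r ≤ rout → 0 ≤ p r)
    {F : ℝ} (hF : ∀ t < 0, ∀ x, f t x ≤ F)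
    (hin : ∀ t < 0, ∀ x, cylRadius x = rin → f t x ≤ p (cylRadius x))
    (hout : ∀ t < 0, ∀ x, cylRadius x = rout → f t x ≤ p (cylRadius x)) :
    ∀ t < 0, ∀ x, rin ≤ cylRadius x → cylRadius x ≤ rout → f t x ≤ p (cylRadius x) := by
  intro tS htS xS hxin hxout
  -- `0 ≤ F` (the axis)
  have hF0 : 0 ≤ F := by
    have h0 : cylRadius (0 : E3) = 0 := by simp [cylRadius]
    have h1 : |f tS 0| ≤ Cg * cylRadius (0 : E3) := hp.axis tS htS 0
    rw [h0, mul_zero] at h1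
    have h2 : f tS 0 = 0 := abs_eq_zero.1 (le_antisymm h1 (abs_nonneg _))
    have := hF tS htS 0
    linarith
  -- constants of the two correctors
  set K : ℝ := |Cu| + 1 / rin with hK
  have hK0 : 0 ≤ K := by positivity
  set γ : ℝ := K + 1 with hγ
  have hKγ : K < γ := by rw [hγ]; linarith
  have hγ0 : 0 < γ := by linarith
  set μ : ℝ := γ * (γ - K) * Real.exp (-(γ * (rout - rin))) / 2 with hμ
  have hμ0 : 0 < μ := by
    have : 0 < γ - K := by linarith
    positivity
  set ν : ℝ := 1 + |Cu| with hν
  have hν0 : 0 ≤ ν := by positivity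
  set Φ : ℝ → ℝ := fun r => 2 * Real.exp (γ * rout) - Real.exp (γ * r) with hΦ
  have hΦC : ContDiff ℝ 2 Φ :=
    contDiff_const.sub (Real.contDiff_exp.comp (contDiff_const.mul contDiff_id))
  have hΦd : ∀ r, HasDerivAt Φ (-(γ * Real.exp (γ * r))) r := fun r => hasDerivAt_initialProfile γ rout r
  have hΦ1 : deriv Φ = fun r => -(γ * Real.exp (γ * r)) := funext fun r => (hΦd r).deriv
  have hΦ2 : ∀ r, iteratedDeriv 2 Φ r = -(γ ^ 2 * Real.exp (γ * r)) :=
    iteratedDeriv_two_eq hΦd (fun r => hasDerivAt_initialProfile' γ r)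
  have hΦ1le : ∀ r, r ≤ rout → 1 ≤ Φ r := fun r hr =>
    initialCorrector_ge_one hγ0.le (hrin.le.trans hio) hr
  -- the local class off the axis
  set U : Set E3 := {x | rin / 2 < cylRadius x} with hU
  have hUo : IsOpen U := isOpen_lt continuous_const continuous_cylRadius
  have hdh : IsDriftHeatSolutionOn (mergedDrift u) f (|Cu| + 2 / (rin / 2)) (Iio 0) U :=
    hp.driftHeat (by positivity)
  have hUr : ∀ x ∈ U, 0 < cylRadius x := fun x hx => lt_trans (by positivity) hx
  set rS := cylRadius xS with hrS
  set z₀ : ℝ := xS 2 with hz₀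
  obtain ⟨hHC, hHD, hHΔ⟩ := lateral_slice z₀
  have hP2 : Continuous fun y : E3 => y 2 := (EuclideanSpace.proj (2 : Fin 3) : E3 →L[ℝ] ℝ).continuous
  ------------------------------------------------------------------
  -- THE BOX STEP
  ------------------------------------------------------------------
  have hbox : ∀ T : ℝ, 0 < T → ∀ Z : ℝ, 0 < Z →
      f tS xS ≤ p rS + F * Real.exp (-(μ * T)) * Φ rS + F * Real.exp (ν * T) / Real.cosh Z := by
    intro T hT Z hZ
    set t_b : ℝ := tS - T with ht_b
    have htb : t_b < tS := by rw [ht_b]; linarith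
    set D : Set E3 := {x | rin ≤ cylRadius x ∧ cylRadius x ≤ rout ∧ |x 2 - z₀| ≤ Z} with hD
    set c₁ : ℝ → ℝ := fun τ => F * Real.exp (-(μ * (τ - t_b))) with hc₁
    set c₂ : ℝ → ℝ := fun τ => F * Real.exp (ν * (τ - t_b)) / Real.cosh Z with hc₂
    set P : E3 → ℝ := fun x => p (cylRadius x) with hP
    set Q : E3 → ℝ := fun x => Φ (cylRadius x) with hQ
    set H : E3 → ℝ := fun x => Real.cosh (x 2 - z₀) with hH
    set φ : ℝ → E3 → ℝ := fun τ x => P x + c₁ τ * Q x + c₂ τ * H x with hφ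
    set φt : ℝ → E3 → ℝ := fun τ x => -μ * c₁ τ * Q x + ν * c₂ τ * H x with hφt
    have hcoshZ : 0 < Real.cosh Z := Real.cosh_pos Z
    have hc₁0 : ∀ τ, 0 ≤ c₁ τ := fun τ => by positivity
    have hc₂0 : ∀ τ, 0 ≤ c₂ τ := fun τ => by positivity
    have hc₁c : Continuous c₁ :=
      continuous_const.mul (Real.continuous_exp.comp ((continuous_const.mul (continuous_id.sub continuous_const)).neg))
    have hc₂c : Continuous c₂ :=
      (continuous_const.mul (Real.continuous_exp.comp (continuous_const.mul (continuous_id.sub continuous_const)))).div_const _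
    have hc₁d : ∀ τ, HasDerivAt c₁ (-μ * c₁ τ) τ := by
      intro τ
      have h1 : HasDerivAt (fun τ => -(μ * (τ - t_b))) (-(μ * 1)) τ :=
        (((hasDerivAt_id' τ).sub_const t_b).const_mul μ).neg
      have h2 := (h1.exp).const_mul F
      exact h2.congr_deriv (by simp only [hc₁]; ring)
    have hc₂d : ∀ τ, HasDerivAt c₂ (ν * c₂ τ) τ := by
      intro τ
      have h1 : HasDerivAt (fun τ => ν * (τ - t_b)) (ν * 1) τ :=
        ((hasDerivAt_id' τ).sub_const t_b).const_mul ν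
      have h2 := ((h1.exp).const_mul F).div_const (Real.cosh Z)
      exact h2.congr_deriv (by simp only [hc₂]; ring)
    -- slice regularity on `U`
    have hPs : ∀ x ∈ U, ContDiffAt ℝ 2 P x := fun x hx =>
      (SliceCalc.barrier_slice_calculus hpC (hUr x hx)).1
    have hQs : ∀ x ∈ U, ContDiffAt ℝ 2 Q x := fun x hx =>
      (SliceCalc.barrier_slice_calculus hΦC.contDiffOn (hUr x hx)).1
    have hHs : ∀ x : E3, ContDiffAt ℝ 2 H x := fun x => hHC.contDiffAt
    have hPd : ∀ x ∈ U, DifferentiableAt ℝ P x := fun x hx => (hPs x hx).differentiableAt (by norm_num)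
    have hQd : ∀ x ∈ U, DifferentiableAt ℝ Q x := fun x hx => (hQs x hx).differentiableAt (by norm_num)
    have hHd : ∀ x : E3, DifferentiableAt ℝ H x := fun x => (hHs x).differentiableAt (by norm_num)
    -- `∇φ`, `Δφ` of the barrier slices on `U`
    have hφD : ∀ τ, ∀ x ∈ U,
        fderiv ℝ (φ τ) x = fderiv ℝ P x + c₁ τ • fderiv ℝ Q x + c₂ τ • fderiv ℝ H x := by
      intro τ x hx
      have h : HasFDerivAt (fun y => P y + c₁ τ * Q y + c₂ τ * H y)
          (fderiv ℝ P x + c₁ τ • fderiv ℝ Q x + c₂ τ • fderiv ℝ H x) x :=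
        ((hPd x hx).hasFDerivAt.fun_add ((hQd x hx).hasFDerivAt.const_mul (c₁ τ))).fun_add
          ((hHd x).hasFDerivAt.const_mul (c₂ τ))
      exact h.fderiv
    have hφΔ : ∀ τ, ∀ x ∈ U, (Δ (φ τ)) x = (Δ P) x + c₁ τ * (Δ Q) x + c₂ τ * (Δ H) x := by
      intro τ x hx
      have h1 : φ τ = P + c₁ τ • Q + c₂ τ • H := by
        funext y; simp only [hφ, Pi.add_apply, Pi.smul_apply, smul_eq_mul]
      have hQ' : ContDiffAt ℝ 2 (c₁ τ • Q) x := by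
        have h := (hQs x hx).const_smul (c₁ τ)
        exact h
      have hH' : ContDiffAt ℝ 2 (c₂ τ • H) x := by
        have h := (hHs x).const_smul (c₂ τ)
        exact h
      have hPQ : ContDiffAt ℝ 2 (P + c₁ τ • Q) x := (hPs x hx).add hQ'
      rw [h1, hPQ.laplacian_add hH', (hPs x hx).laplacian_add hQ',
        InnerProductSpace.laplacian_smul _ (hQs x hx), InnerProductSpace.laplacian_smul _ (hHs x),
        smul_eq_mul, smul_eq_mul]
    -- the three operator values
    have hPop : ∀ τ, ∀ x ∈ U, (Δ P) x - fderiv ℝ P x (u τ x + (2 / cylRadius x) • eR x) =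
        iteratedDeriv 2 p (cylRadius x)
          + (-(x 0 * u τ x 0 + x 1 * u τ x 1) - 1) / cylRadius x * deriv p (cylRadius x) :=
      fun τ x hx => radial_operator hpC (hUr x hx) (u τ x)
    have hQop : ∀ τ, ∀ x ∈ U, (Δ Q) x - fderiv ℝ Q x (u τ x + (2 / cylRadius x) • eR x) =
        -(γ ^ 2 * Real.exp (γ * cylRadius x))
          + (-(x 0 * u τ x 0 + x 1 * u τ x 1) - 1) / cylRadius x * (-(γ * Real.exp (γ * cylRadius x))) := by
      intro τ x hx
      rw [show Q = fun w : E3 => Φ (cylRadius w) from rfl, radial_operator hΦC.contDiffOn (hUr x hx) (u τ x),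
        hΦ2, hΦ1]
    have hHop : ∀ τ (x : E3), (Δ H) x - fderiv ℝ H x (u τ x + (2 / cylRadius x) • eR x) =
        Real.cosh (x 2 - z₀) - Real.sinh (x 2 - z₀) * u τ x 2 := by
      intro τ x
      rw [hHΔ x, hHD x]
      simp
    -- the super-solution inequality on the interior of the box
    have hineq' : ∀ τ ∈ Ioc t_b tS, ∀ x ∈ interior D,
        (Δ (φ τ)) x - fderiv ℝ (φ τ) x (mergedDrift u τ x) ≤ φt τ x := by
      intro τ hτ x hx'
      have hxD : x ∈ D := interior_subset hx'
      obtain ⟨hx1, hx2, hx3⟩ := hxD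
      have hxU : x ∈ U := by show rin / 2 < cylRadius x; linarith
      have hr0 : 0 < cylRadius x := hUr x hxU
      have hτ0 : τ < 0 := lt_of_le_of_lt hτ.2 htS
      set v' : E3 := u τ x + (2 / cylRadius x) • eR x with hv'
      have hmd : mergedDrift u τ x = v' := rfl
      set m : ℝ := -(x 0 * u τ x 0 + x 1 * u τ x 1) with hm
      have hmle : |m| ≤ cylRadius x * |Cu| := by
        rw [hm, abs_neg]
        exact (abs_inflow_le x (u τ x)).trans
          (mul_le_mul_of_nonneg_left ((hp.drift τ hτ0 x).trans (le_abs_self _)) (cylRadius_nonneg x))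
      have hκ : |(m - 1) / cylRadius x| ≤ K := by
        rw [abs_div, abs_of_pos hr0, div_le_iff₀ hr0, hK]
        have h1 : |m - 1| ≤ |m| + 1 := by
          calc |m - 1| ≤ |m| + |(1:ℝ)| := abs_sub _ _
            _ = |m| + 1 := by rw [abs_one]
        have h2 : (|Cu| + 1 / rin) * cylRadius x = cylRadius x * |Cu| + cylRadius x / rin := by ring
        rw [h2]
        have h3 : 1 ≤ cylRadius x / rin := by rw [le_div_iff₀ hrin]; linarith
        linarith
      have ha : (Δ P) x - fderiv ℝ P x v' ≤ 0 := by
        rw [hPop τ x hxU]; exact hineq τ hτ0 x hx1 hx2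
      have hQi := initialCorrector_ineq (R := rout) (r := cylRadius x) hK0 hKγ hx1 hκ
      have hb : (Δ Q) x - fderiv ℝ Q x v' ≤ -μ * Q x := by
        rw [hQop τ x hxU, show Q x = 2 * Real.exp (γ * rout) - Real.exp (γ * cylRadius x) from rfl, hμ]
        linarith [hQi]
      have hco : 0 < Real.cosh (x 2 - z₀) := Real.cosh_pos _
      have hsi : |Real.sinh (x 2 - z₀)| ≤ Real.cosh (x 2 - z₀) :=
        abs_le_of_sq_le_sq (by rw [Real.cosh_sq]; linarith) hco.le
      have huz : |u τ x 2| ≤ |Cu| := by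
        have h1 : |u τ x 2| ≤ ‖u τ x‖ := by
          have := PiLp.norm_apply_le (u τ x) 2
          simpa using this
        exact h1.trans ((hp.drift τ hτ0 x).trans (le_abs_self _))
      have hHi := lateralCorrector_ineq (β := 1) (ν := ν) hco hsi huz zero_le_one (by rw [hν]; linarith)
      have hd : (Δ H) x - fderiv ℝ H x v' ≤ ν * H x := by
        rw [hHop τ x, show H x = Real.cosh (x 2 - z₀) from rfl]
        linarith [hHi]
      have hc1 := hc₁0 τ
      have hc2 := hc₂0 τ
      have hb2 := mul_le_mul_of_nonneg_left hb hc1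
      have hd2 := mul_le_mul_of_nonneg_left hd hc2
      rw [hφΔ τ x hxU, hφD τ x hxU, hmd]
      show (Δ P) x + c₁ τ * (Δ Q) x + c₂ τ * (Δ H) x
          - (fderiv ℝ P x + c₁ τ • fderiv ℝ Q x + c₂ τ • fderiv ℝ H x) v'
          ≤ -μ * c₁ τ * Q x + ν * c₂ τ * H x
      simp only [add_apply, FunLike.coe_smul, Pi.smul_apply, smul_eq_mul]
      have key : (Δ P) x + c₁ τ * (Δ Q) x + c₂ τ * (Δ H) x
            - (fderiv ℝ P x v' + c₁ τ * fderiv ℝ Q x v' + c₂ τ * fderiv ℝ H x v')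
          = ((Δ P) x - fderiv ℝ P x v') + c₁ τ * ((Δ Q) x - fderiv ℝ Q x v')
            + c₂ τ * ((Δ H) x - fderiv ℝ H x v') := by ring
      have e1 : c₁ τ * (-μ * Q x) = -μ * c₁ τ * Q x := by ring
      have e2 : c₂ τ * (ν * H x) = ν * c₂ τ * H x := by ring
      linarith [key, ha, hb2, hd2, e1, e2]
    -- the bottom of the box
    have hbot : ∀ x ∈ D, f t_b x ≤ φ t_b x := by
      intro x hx
      obtain ⟨hx1, hx2, hx3⟩ := hx
      have htb0 : t_b < 0 := htb.trans htS
      have h1 : f t_b x ≤ F := hF t_b htb0 x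
      have hΦ1 : 1 ≤ Φ (cylRadius x) := hΦ1le _ hx2
      have hc1 : c₁ t_b = F := by simp [hc₁]
      show f t_b x ≤ p (cylRadius x) + c₁ t_b * Φ (cylRadius x) + c₂ t_b * Real.cosh (x 2 - z₀)
      rw [hc1]
      have h2 : 0 ≤ c₂ t_b * Real.cosh (x 2 - z₀) := mul_nonneg (hc₂0 _) (Real.cosh_pos _).le
      have h3 : F ≤ F * Φ (cylRadius x) := le_mul_of_one_le_right hF0 hΦ1
      linarith [hp0 _ hx1 hx2]
    -- the three faces
    have hside : ∀ τ ∈ Icc t_b tS, ∀ x ∈ D \ interior D, f τ x ≤ φ τ x := by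
      intro τ hτ x hx
      obtain ⟨⟨hx1, hx2, hx3⟩, hxni⟩ := hx
      have hτ0 : τ < 0 := lt_of_le_of_lt hτ.2 htS
      have hge1 : 0 ≤ c₁ τ * Φ (cylRadius x) :=
        mul_nonneg (hc₁0 τ) (zero_le_one.trans (hΦ1le _ hx2))
      have hge2 : 0 ≤ c₂ τ * Real.cosh (x 2 - z₀) := mul_nonneg (hc₂0 τ) (Real.cosh_pos _).le
      have hge0 : 0 ≤ p (cylRadius x) := hp0 _ hx1 hx2
      show f τ x ≤ p (cylRadius x) + c₁ τ * Φ (cylRadius x) + c₂ τ * Real.cosh (x 2 - z₀)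
      have halt : cylRadius x = rin ∨ cylRadius x = rout ∨ |x 2 - z₀| = Z := by
        by_contra hcon
        push Not at hcon
        obtain ⟨h1, h2, h3⟩ := hcon
        apply hxni
        have hO : IsOpen {y : E3 | rin < cylRadius y ∧ cylRadius y < rout ∧ |y 2 - z₀| < Z} :=
          (isOpen_lt continuous_const continuous_cylRadius).inter
            ((isOpen_lt continuous_cylRadius continuous_const).inter
              (isOpen_lt ((hP2.sub continuous_const).abs) continuous_const))
        refine interior_maximal (fun y hy => ?_) hO
          ⟨lt_of_le_of_ne hx1 (Ne.symm h1), lt_of_le_of_ne hx2 h2, lt_of_le_of_ne hx3 h3⟩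
        exact ⟨hy.1.le, hy.2.1.le, hy.2.2.le⟩
      rcases halt with h | h | h
      · have := hin τ hτ0 x h; linarith
      · have := hout τ hτ0 x h; linarith
      · have hcz : Real.cosh (x 2 - z₀) = Real.cosh Z := by rw [← Real.cosh_abs, h]
        have hc2v : c₂ τ * Real.cosh (x 2 - z₀) = F * Real.exp (ν * (τ - t_b)) := by
          rw [hcz, hc₂]; field_simp
        have hexp : 1 ≤ Real.exp (ν * (τ - t_b)) :=
          Real.one_le_exp (mul_nonneg hν0 (by linarith [hτ.1]))
        have h4 : F ≤ F * Real.exp (ν * (τ - t_b)) := le_mul_of_one_le_right hF0 hexp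
        linarith [hF τ hτ0 x]
    -- structural hypotheses of S1
    have hIcc : Icc t_b tS ⊆ Iio 0 := fun τ hτ => lt_of_le_of_lt hτ.2 htS
    have hDc : IsCompact D := by
      refine Metric.isCompact_of_isClosed_isBounded ?_ ?_
      · exact (isClosed_le continuous_const continuous_cylRadius).inter
          ((isClosed_le continuous_cylRadius continuous_const).inter
            (isClosed_le ((hP2.sub continuous_const).abs) continuous_const))
      · refine (Metric.isBounded_closedBall (x := (0 : E3)) (r := rout + (|z₀| + Z))).subset fun y hy => ?_
        obtain ⟨-, hy2, hy3⟩ := hy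
        rw [Metric.mem_closedBall, dist_zero_right]
        have hn : ‖y‖ ^ 2 = cylRadius y ^ 2 + y 2 ^ 2 := by
          rw [EuclideanSpace.norm_sq_eq, cylRadius_sq]
          simp [Fin.sum_univ_three, sq_abs]
        have hy2' : |y 2| ≤ |z₀| + Z := by
          have := abs_sub_abs_le_abs_sub (y 2) z₀; linarith
        have hb : ‖y‖ ≤ cylRadius y + |y 2| := by
          have h := abs_le_of_sq_le_sq (a := ‖y‖) (b := cylRadius y + |y 2|)
            (by rw [hn]; nlinarith [cylRadius_nonneg y, abs_nonneg (y 2), sq_abs (y 2)])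
            (add_nonneg (cylRadius_nonneg y) (abs_nonneg _))
          rwa [abs_of_nonneg (norm_nonneg y)] at h
        linarith
    have hDU : D ⊆ U := fun y hy => by
      obtain ⟨hy1, -, -⟩ := hy
      show rin / 2 < cylRadius y
      linarith
    have hφc : ContinuousOn (uncurry φ) (Icc t_b tS ×ˢ U) := by
      have hPc : ContinuousOn (fun q : ℝ × E3 => P q.2) (Icc t_b tS ×ˢ U) := by
        refine hpC.continuousOn.comp (continuous_cylRadius.comp continuous_snd).continuousOn ?_
        intro q hq
        exact hUr q.2 (mem_prod.1 hq).2
      have hQc : Continuous (fun q : ℝ × E3 => Q q.2) :=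
        hΦC.continuous.comp (continuous_cylRadius.comp continuous_snd)
      have hHc : Continuous (fun q : ℝ × E3 => H q.2) := hHC.continuous.comp continuous_snd
      have h : ContinuousOn (fun q : ℝ × E3 => P q.2 + c₁ q.1 * Q q.2 + c₂ q.1 * H q.2) (Icc t_b tS ×ˢ U) :=
        (hPc.add (((hc₁c.comp continuous_fst).mul hQc).continuousOn)).add
          (((hc₂c.comp continuous_fst).mul hHc).continuousOn)
      exact h
    have hφ2 : ∀ τ ∈ Icc t_b tS, ContDiffOn ℝ 2 (φ τ) U := fun τ _ x hx =>
      (((hPs x hx).add (contDiffAt_const.mul (hQs x hx))).add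
        (contDiffAt_const.mul (hHs x))).contDiffWithinAt
    have hφt' : ∀ x ∈ U, ∀ τ ∈ Icc t_b tS, HasDerivAt (fun τ => φ τ x) (φt τ x) τ := by
      intro x _ τ _
      show HasDerivAt (fun τ => P x + c₁ τ * Q x + c₂ τ * H x) (-μ * c₁ τ * Q x + ν * c₂ τ * H x) τ
      exact (((hasDerivAt_const τ (P x)).add ((hc₁d τ).mul_const (Q x))).add
        ((hc₂d τ).mul_const (H x))).congr_deriv (by ring)
    have hφt_c : ∀ x ∈ U, ContinuousOn (fun τ => φt τ x) (Icc t_b tS) := fun x _ =>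
      (((continuous_const.mul hc₁c).mul continuous_const).add
        ((continuous_const.mul hc₂c).mul continuous_const)).continuousOn
    have hφD_c : ∀ x ∈ U, ContinuousOn (fun τ => fderiv ℝ (φ τ) x) (Icc t_b tS) := by
      intro x hx
      have h : Continuous fun τ => fderiv ℝ P x + c₁ τ • fderiv ℝ Q x + c₂ τ • fderiv ℝ H x :=
        (continuous_const.add (hc₁c.smul continuous_const)).add (hc₂c.smul continuous_const)
      exact h.continuousOn.congr fun τ _ => hφD τ x hx
    have hφΔ_c : ∀ x ∈ U, ContinuousOn (fun τ => (Δ (φ τ)) x) (Icc t_b tS) := by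
      intro x hx
      have h : Continuous fun τ => (Δ P) x + c₁ τ * (Δ Q) x + c₂ τ * (Δ H) x :=
        (continuous_const.add (hc₁c.mul continuous_const)).add (hc₂c.mul continuous_const)
      exact h.continuousOn.congr fun τ _ => hφΔ τ x hx
    -- S1
    have hmem : xS ∈ D := ⟨hxin, hxout, by simp [hz₀, hZ.le]⟩
    have hres := hS1 hdh hUo hIcc hDc hDU hφc hφ2 hφt' hφt_c hφD_c hφΔ_c hineq' hbot hside tS
      ⟨htb.le, le_rfl⟩ xS hmem
    have hc1T : c₁ tS = F * Real.exp (-(μ * T)) := by simp [hc₁, ht_b]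
    have hc2T : c₂ tS = F * Real.exp (ν * T) / Real.cosh Z := by simp [hc₂, ht_b]
    have hH0 : H xS = 1 := by simp [hH, hz₀]
    have hval : φ tS xS = p rS + F * Real.exp (-(μ * T)) * Φ rS + F * Real.exp (ν * T) / Real.cosh Z := by
      show P xS + c₁ tS * Q xS + c₂ tS * H xS = _
      rw [hc1T, hc2T, hH0, mul_one]
    linarith [hres]
  ------------------------------------------------------------------
  -- THE TWO LIMITS: `Z → ∞`, then `T → ∞`
  ------------------------------------------------------------------
  have hΦrS : 0 ≤ Φ rS := zero_le_one.trans (hΦ1le _ hxout)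
  have hT : ∀ T : ℝ, 0 < T → f tS xS ≤ p rS + F * Real.exp (-(μ * T)) * Φ rS := by
    intro T hT
    refine le_of_forall_pos_lt_add fun ε hε => ?_
    have hlim : Tendsto (fun Z : ℝ => 2 * (F * Real.exp (ν * T)) * Real.exp (-Z)) atTop
        (𝓝 (2 * (F * Real.exp (ν * T)) * 0)) :=
      Real.tendsto_exp_neg_atTop_nhds_zero.const_mul _
    rw [mul_zero] at hlim
    obtain ⟨Z, hZ1, hZ2⟩ := ((hlim.eventually (gt_mem_nhds hε)).and (eventually_gt_atTop 0)).exists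
    have hb := hbox T hT Z hZ2
    have hcosh : Real.exp Z / 2 ≤ Real.cosh Z := by
      rw [Real.cosh_eq]; have := Real.exp_pos (-Z); linarith
    have h3 : F * Real.exp (ν * T) / Real.cosh Z ≤ 2 * (F * Real.exp (ν * T)) * Real.exp (-Z) := by
      rw [div_le_iff₀ (Real.cosh_pos Z)]
      calc F * Real.exp (ν * T) = 2 * (F * Real.exp (ν * T)) * Real.exp (-Z) * (Real.exp Z / 2) := by
            rw [Real.exp_neg]; field_simp
        _ ≤ 2 * (F * Real.exp (ν * T)) * Real.exp (-Z) * Real.cosh Z :=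
            mul_le_mul_of_nonneg_left hcosh (by positivity)
    linarith
  refine le_of_forall_pos_lt_add fun ε hε => ?_
  have hlim : Tendsto (fun T : ℝ => F * Φ rS * Real.exp (-(μ * T))) atTop (𝓝 (F * Φ rS * 0)) := by
    refine Tendsto.const_mul _ ?_
    have h1 : Tendsto (fun T : ℝ => μ * T) atTop atTop := tendsto_id.const_mul_atTop hμ0
    have h2 := Real.tendsto_exp_neg_atTop_nhds_zero.comp h1
    exact h2
  rw [mul_zero] at hlim
  obtain ⟨T, hT1, hT2⟩ := ((hlim.eventually (gt_mem_nhds hε)).and (eventually_gt_atTop 0)).exists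
  have h := hT T hT2
  have e : F * Real.exp (-(μ * T)) * Φ rS = F * Φ rS * Real.exp (-(μ * T)) := by ring
  linarith


end Summit.NavierStokesRegularity.NavierStokesRegularity.Theorems.ScenarioCensus.FellerSwirl

end
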